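import Summits.BirchSwinnertonDyer.BirchSwinnertonDyer.Theorems.ByReductionTypeAtTwoAnalyticMuZero
import Summits.BirchSwinnertonDyer.Rank1Residual.X1.MuPart
import Literature.NumberTheory.EllipticCurves.SkinnerUrban2014.PAdicUnitPeriodRatioAnyPrimeProofs
import Literature.NumberTheory.EllipticCurves.Rank1Residual.PeriodUnitProofs
import HarnessLib

/-!
# Route `ByReductionTypeAtTwo` (K4), TOWER road — the CERTIFICATE binder `hμan : AnalyticMuLE W 2 0` of the TOWER
# `BSDp@2` doors DISCHARGED on every good-ordinary-at-`2`, `E[2]`-irreducible curve, modulo the print binder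
# `hAU` (Abbes–Ullmo) the doors already carry

Cell `bsd-2adic`, seat `bsd-2adic-tower-1` (GEN 24), `--supports stmt-BirchSwinnertonDyer-19271` (helper; S4 of the
planner's cut RC-250 / RC-254).  Theorems only; no definition, no named fact taken except the DISPLAYED print
hypothesis `hAU : abbesUllmo_not_dvd_maninConstant_of_not_dvd_level` (Abbes–Ullmo 1996 Thm. A, the TOWER doors'
own period binder: `ByReductionTypeAtTwoTowerClassKitB.mainConjectureLowerDivisibilityAtTwoOrd_of_towerGap_of_abbesUllmo`,
`ByReductionTypeAtTwoTowerClassKit.periodRatio_nonneg_of_irr_two_of_abbesUllmo`); no `sorry`.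

## Statement

`X1.MuPart.AnalyticMuLE W 2 0` — «`μ_an(E, 2) ≤ 0`»: for the newform `f` of `W` at level `N_E` and every rational
`ϖ` with `ϖ·Ω_W = Ω⁺_f`, SOME coefficient of `ϖ·L₂(f, α, T)` has `2`-adic norm `> 2⁻¹` — is the `hμan` input of
`KatoHalfPinch.bsdp_two_of_towerGap_of_towerRank` / `…_of_layerSelmer_of_greenberg` and of every per-class TOWER
display (`Theorems/ByReductionTypeAtTwoTowerClass<label>.lean`, binder `(hμan : AnalyticMuLE c<label> 2 0)`), typed
there as a per-curve CERTIFICATE.  Here it is a THEOREM on the whole locus {`GoodOrd W 2`, `Irr W 2`} (the 440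
`E[2]`-irreducible X5@2 good-ordinary rows and beyond), modulo `hAU`:

* `analyticMuLE_two_zero_of_irr_of_abbesUllmo : hAU → IsOrdinaryAt W 2 → W.HasIrreducibleModPGaloisRep 2 →
  AnalyticMuLE W 2 0` (and the `GoodOrd`/`Irr` spelling `analyticMuLE_two_zero_of_goodOrd_of_irr_of_abbesUllmo`).

Proof: `ByReductionTypeAtTwoAnalyticMuZero.exists_norm_padicLCoeff_two_eq_one` (a UNIT coefficient of `L₂(f,α,T)`,
kernel, this seat) and `‖ϖ‖₂ = 1` (`realPeriodRat_eq_unit_mul_plusPeriod_two_of_abbesUllmo` +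
`padicValRat_periodRatio_eq_zero_of_eq_unit_mul`: `Ω_W = u·Ω⁺_f`, `‖u‖₂ = 1`, from Abbes–Ullmo via Greenberg–Vatsal
Rem. 3.4 on the `E[2]`-irreducible isogeny class).  An `hAU`-free variant would need the two inequalities
`0 ≤ v₂(ϖ)` (integrality of `ϖ·L₂`) and `v₂(ϖ) ≤ 0` separately; the tree has neither without `hAU` (planner RC-254
zero-price suggestion: recorded, not cheap).

HONEST FRAMING: conditional on the print binder `hAU` only; no door is re-keyed here (D-0152: the planner decides);
nothing booked; BSD is not proved by any of this.

References: [AbbesUllmo1996] Thm. A; [GreenbergVatsal2000] §3 Rem. 3.4, (2)–(3); [GreenbergLNM1716] §1 Conj. 1.11.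
-/

-- the summit namespace repeats `BirchSwinnertonDyer` by design (summit = problem); linter moot
set_option linter.dupNamespace false
set_option autoImplicit false

noncomputable section

namespace Summit.BirchSwinnertonDyer.BirchSwinnertonDyer.Theorems.AnalyticMuTwo

open scoped MatrixGroups ModularForm

open CongruenceSubgroup WeierstrassCurve Literature.NumberTheory.EllipticCurves
  Literature.NumberTheory.EllipticCurves.ModularForms Literature.NumberTheory.EllipticCurves.Rank1Residual
  Literature.NumberTheory.EllipticCurves.SkinnerUrban2014
  Summit.BirchSwinnertonDyer.Rank1Residual.X1.MuPart

section Tower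

variable (W : WeierstrassCurve ℚ) [W.IsElliptic] [W.IsGloballyMinimal]

/-- **`hμan : AnalyticMuLE W 2 0` DISCHARGED on {good ordinary at `2`, `E[2]` irreducible}, modulo `hAU`.**  For the
newform `f` of `W` at level `N_E` and every `ϖ ∈ ℚ` with `ϖ·Ω_W = Ω⁺_f`: some coefficient of `ϖ·L₂(f, α, T)` has norm
`> 2⁻¹` (indeed `= 1`: a unit coefficient of `L₂(f,α,T)` by `exists_norm_padicLCoeff_two_eq_one`, and `‖ϖ‖₂ = 1`
by Abbes–Ullmo on the irreducible class). [cite: AbbesUllmo1996, Thm. A]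
[cite: GreenbergVatsal2000, §3, Remark 3.4] [cite: GreenbergLNM1716, §1 Conj. 1.11 (posed for all p; the p = 2 analytic reading is ours)] -/
theorem analyticMuLE_two_zero_of_irr_of_abbesUllmo (hAU : abbesUllmo_not_dvd_maninConstant_of_not_dvd_level)
    (hord : IsOrdinaryAt W 2) (hirr : W.HasIrreducibleModPGaloisRep 2) : AnalyticMuLE W 2 0 := by
  intro _ f hf ϖ hϖ
  haveI : Fact (Nat.Prime 2) := ⟨Nat.prime_two⟩
  obtain ⟨k, hk⟩ := exists_norm_padicLCoeff_two_eq_one W hord hirr hf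
  obtain ⟨u, hu, hΩ⟩ := realPeriodRat_eq_unit_mul_plusPeriod_two_of_abbesUllmo hAU W hord.1 hirr f hf
  have hv : padicValRat 2 ϖ = 0 := padicValRat_periodRatio_eq_zero_of_eq_unit_mul W 2 f hu hΩ ϖ hϖ
  -- `ϖ ≠ 0` since `Ω⁺_f > 0`
  have hΩpos : 0 < plusPeriod f :=
    (plusPeriod_pos_and_realPeriods_eq isZLattice_periodLattice_holds hf.1 hf.coeffField_eq_bot).1
  have hϖ0 : ϖ ≠ 0 := by
    rintro rfl
    rw [Rat.cast_zero, zero_mul] at hϖ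
    exact hΩpos.ne hϖ
  have hϖ1 : 1 ≤ ‖((ϖ : ℚ) : ℚ_[2])‖ := one_le_norm_ratCast_of_padicValRat_eq_zero hϖ0 hv
  refine ⟨k, ?_⟩
  rw [PowerSeries.coeff_C_mul, norm_mul, coeff_padicLFunction, hk, mul_one]
  have h1 : ((2 : ℕ) : ℝ) ^ (-(((0 : ℕ) : ℤ) + 1)) < 1 := by norm_num
  exact h1.trans_le hϖ1

/-- The same in the TOWER doors' spelling `GoodOrd W 2` / `Irr W 2`. [cite: AbbesUllmo1996, Thm. A]
[cite: GreenbergLNM1716, §1 Conj. 1.11 (posed for all p; the p = 2 analytic reading is ours)] -/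
theorem analyticMuLE_two_zero_of_goodOrd_of_irr_of_abbesUllmo
    (hAU : abbesUllmo_not_dvd_maninConstant_of_not_dvd_level) (hgo : GoodOrd W 2) (hirr : Irr W 2) :
    AnalyticMuLE W 2 0 :=
  analyticMuLE_two_zero_of_irr_of_abbesUllmo W hAU hgo hirr

end Tower

end Summit.BirchSwinnertonDyer.BirchSwinnertonDyer.Theorems.AnalyticMuTwo

end
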